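import Mathlib
import Summits.Ventures.PercRepro2.Defs
import Summits.Ventures.PercRepro2.Independence
import Summits.Ventures.PercRepro2.Harris
import Summits.Ventures.PercRepro2.Graph

/-!
# Disjoint occurrence of connection events and the switching inequality (blind cell PercRepro2, typer-1)

Typing of mine-1's rows R13 and R13-comb (`conjectures/R13-STATEMENT.md`).

* `ofFinset S` — the configuration with exactly the edges of `S` open; `Carries ends S x y` —
  `S` carries an `x–y` path (`x ↔ y` in `ofFinset S`);
* `disjointConnEvent ends s a b` = `{s ↔ a} ∘ {s ↔ b}`: there are edge-disjoint open witnesses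
  `K` of `s ↔ a` and `L` of `s ↔ b` (van den Berg–Kesten's disjoint occurrence for two
  connection events rooted at `s`);
* **R13**: `P({s↔a}∘{s↔b}, s↔t) · P(s↔t) ≤ P(s↔a, s↔t) · P(s↔b, s↔t)` — the BK inequality for
  two connection events of `s` survives conditioning on a third connection event of `s`;
* **R13-comb** (the switching inequality, `R13-STATEMENT.md` §2): for a 2-colouring of the edge
  set, red `= S`, blue `= Sᶜ`,
  `ℒ = {S : S carries edge-disjoint s–a and s–b paths, S and Sᶜ both carry an s–t path}`,
  `ℛ = {S : S carries an s–a path, Sᶜ an s–b path, S and Sᶜ both carry an s–t path}`,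
  and the claim is `|ℒ| ≤ |ℛ|`.  mine-1's Theorem 2.3: R13-comb for all multigraphs implies
  R13 for all weights (two-configuration Bernstein expansion + contraction).
-/

namespace Summit.Ventures.PercRepro2

/-! ## Configurations of edge sets -/

section OfFinset

variable {E : Type*} [DecidableEq E]

/-- The configuration with exactly the edges of `S` open. -/
def ofFinset (S : Finset E) : Config E := fun e => decide (e ∈ S)

/-- `ofFinset` at an edge. -/
@[simp] lemma ofFinset_apply (S : Finset E) (e : E) : ofFinset S e = decide (e ∈ S) := rfl

/-- An edge is open in `ofFinset S` iff it lies in `S`. -/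
lemma ofFinset_eq_true_iff {S : Finset E} {e : E} : ofFinset S e = true ↔ e ∈ S := by
  simp

/-- `ofFinset` is monotone. -/
lemma ofFinset_mono {S T : Finset E} (h : S ⊆ T) : ofFinset S ≤ ofFinset T := by
  intro e
  by_cases he : e ∈ S
  · simp [he, h he]
  · simp [he]

/-- `ofFinset S ≤ ω` iff every edge of `S` is open in `ω`. -/
lemma ofFinset_le_iff {S : Finset E} {ω : Config E} : ofFinset S ≤ ω ↔ ∀ e ∈ S, ω e = true := by
  constructor
  · intro h e he
    have := h e
    rw [ofFinset_apply, decide_eq_true he] at this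
    exact Bool.le_iff_imp.1 this rfl
  · intro h e
    by_cases he : e ∈ S
    · rw [ofFinset_apply, decide_eq_true he, h e he]
    · rw [ofFinset_apply, decide_eq_false he]
      exact Bool.false_le _

end OfFinset

/-! ## Carried paths and disjoint occurrence -/

section Carries

variable {V : Type*} {E : Type*} [DecidableEq E]

/-- `S` carries an `x–y` path: `x ↔ y` in the configuration with exactly `S` open. -/
def Carries (ends : E → Sym2 V) (S : Finset E) (x y : V) : Prop := Conn ends (ofFinset S) x y

/-- Carried paths are monotone in the edge set. -/
lemma Carries.mono {ends : E → Sym2 V} {S T : Finset E} (h : S ⊆ T) {x y : V}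
    (hS : Carries ends S x y) : Carries ends T x y :=
  conn_mono (ofFinset_mono h) hS

/-- A carried path is an open path in every configuration opening `S`. -/
lemma Carries.conn {ends : E → Sym2 V} {S : Finset E} {ω : Config E}
    (hω : ∀ e ∈ S, ω e = true) {x y : V} (hS : Carries ends S x y) : Conn ends ω x y :=
  conn_mono (ofFinset_le_iff.2 hω) hS

/-- `S` carries edge-disjoint witnesses of `s ↔ a` and `s ↔ b`. -/
def CarriesDisjoint (ends : E → Sym2 V) (S : Finset E) (s a b : V) : Prop :=
  ∃ K L : Finset E, Disjoint K L ∧ K ⊆ S ∧ L ⊆ S ∧ Carries ends K s a ∧ Carries ends L s b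

/-- **Disjoint occurrence** `{s ↔ a} ∘ {s ↔ b}`: some edge-disjoint open edge sets `K`, `L`
carry an `s–a` path and an `s–b` path respectively. -/
def disjointConnEvent (ends : E → Sym2 V) (s a b : V) : Set (Config E) :=
  {ω | ∃ K L : Finset E, Disjoint K L ∧ (∀ e ∈ K, ω e = true) ∧ (∀ e ∈ L, ω e = true) ∧
    Carries ends K s a ∧ Carries ends L s b}

/-- Membership in `disjointConnEvent`. -/
lemma mem_disjointConnEvent {ends : E → Sym2 V} {s a b : V} {ω : Config E} :
    ω ∈ disjointConnEvent ends s a b ↔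
      ∃ K L : Finset E, Disjoint K L ∧ (∀ e ∈ K, ω e = true) ∧ (∀ e ∈ L, ω e = true) ∧
        Carries ends K s a ∧ Carries ends L s b := Iff.rfl

/-- `{s ↔ a} ∘ {s ↔ b} ⊆ {s ↔ a} ∩ {s ↔ b}`. -/
lemma disjointConnEvent_subset (ends : E → Sym2 V) (s a b : V) :
    disjointConnEvent ends s a b ⊆ connEvent ends s a ∩ connEvent ends s b := by
  rintro ω ⟨K, L, _, hK, hL, hKa, hLb⟩
  exact ⟨hKa.conn hK, hLb.conn hL⟩

/-- `{s ↔ a} ∘ {s ↔ b}` is increasing. -/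
lemma isUpperSet_disjointConnEvent (ends : E → Sym2 V) (s a b : V) :
    IsUpperSet (disjointConnEvent ends s a b) := by
  rintro ω ω' h ⟨K, L, hKL, hK, hL, hKa, hLb⟩
  refine ⟨K, L, hKL, fun e he => ?_, fun e he => ?_, hKa, hLb⟩
  · have := h e
    rw [hK e he] at this
    exact Bool.le_iff_imp.1 this rfl
  · have := h e
    rw [hL e he] at this
    exact Bool.le_iff_imp.1 this rfl

/-- The configuration `ofFinset S` lies in `{s ↔ a} ∘ {s ↔ b}` iff `S` carries disjoint
witnesses. -/
lemma ofFinset_mem_disjointConnEvent_iff (ends : E → Sym2 V) (S : Finset E) (s a b : V) :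
    ofFinset S ∈ disjointConnEvent ends s a b ↔ CarriesDisjoint ends S s a b := by
  simp only [mem_disjointConnEvent, CarriesDisjoint, ofFinset_eq_true_iff]
  exact exists₂_congr fun K L => by
    rw [Finset.subset_iff, Finset.subset_iff]

end Carries

/-! ## R13 (the probabilistic row) -/

section R13

variable {V : Type*} {E : Type*} [Fintype E] [DecidableEq E] {R : Type*} [CommRing R]
  [PartialOrder R]

/-- **R13** (mine-1): `P({s↔a}∘{s↔b}, s↔t) · P(s↔t) ≤ P(s↔a, s↔t) · P(s↔b, s↔t)`, i.e.
`P(A ∘ B | s ↔ t) ≤ P(A | s ↔ t) · P(B | s ↔ t)` for `A = {s ↔ a}`, `B = {s ↔ b}`. -/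
def R13 (p : E → R) (ends : E → Sym2 V) (s t a b : V) : Prop :=
  prob p (disjointConnEvent ends s a b ∩ connEvent ends s t) * prob p (connEvent ends s t) ≤
    prob p (connEvent ends s a ∩ connEvent ends s t) *
      prob p (connEvent ends s b ∩ connEvent ends s t)

end R13

/-! ## R13-comb (the switching inequality) -/

section Switching

variable {V : Type*} {E : Type*} [Fintype E] [DecidableEq E]

/-- `ℒ(H)`: red `= S` carries edge-disjoint `s–a` and `s–b` paths, and both colours carry an
`s–t` path. -/
def switchingL (ends : E → Sym2 V) (s t a b : V) : Set (Finset E) :=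
  {S | CarriesDisjoint ends S s a b ∧ Carries ends S s t ∧ Carries ends Sᶜ s t}

/-- `ℛ(H)`: red `= S` carries an `s–a` path, blue `= Sᶜ` an `s–b` path, and both colours carry an
`s–t` path. -/
def switchingR (ends : E → Sym2 V) (s t a b : V) : Set (Finset E) :=
  {S | Carries ends S s a ∧ Carries ends Sᶜ s b ∧ Carries ends S s t ∧ Carries ends Sᶜ s t}

/-- **R13-comb** (the switching inequality): `|ℒ(H)| ≤ |ℛ(H)|`. -/
def R13Comb (ends : E → Sym2 V) (s t a b : V) : Prop :=
  (switchingL ends s t a b).ncard ≤ (switchingR ends s t a b).ncard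

end Switching

/-! ## Closures -/

section Closures

/-- R13-comb for every finite multigraph (`ends : E → Sym2 V`, parallel edges allowed) and all
`s, t, a, b` with `t, a, b ≠ s`, `a ≠ b` (mine-1's hypotheses). -/
def R13Comb_all : Prop :=
  ∀ (V E : Type) [Fintype V] [DecidableEq V] [Fintype E] [DecidableEq E] (ends : E → Sym2 V)
    (s t a b : V), t ≠ s → a ≠ s → b ≠ s → a ≠ b → R13Comb ends s t a b

variable (R : Type) [Field R] [LinearOrder R] [IsStrictOrderedRing R]

/-- R13 for every finite multigraph, admissible weights and all `s, t, a, b` with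
`t, a, b ≠ s`, `a ≠ b`. -/
def R13_all : Prop :=
  ∀ (V E : Type) [Fintype V] [DecidableEq V] [Fintype E] [DecidableEq E] (ends : E → Sym2 V)
    (p : E → R), IsProbVec p → ∀ s t a b : V, t ≠ s → a ≠ s → b ≠ s → a ≠ b → R13 p ends s t a b

end Closures

end Summit.Ventures.PercRepro2
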